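import Summits.CriticalPhenomena.SAWScalingLimit.Theorems.SAWRenewalTightnessSubseqIdentificationTiltedEnvelope
import Literature.Probability.RandomPlanarGeometry.SLERestrictionMartingaleExistsKappa
import Literature.Probability.RandomPlanarGeometry.SLEImageLocalMartingale
import HarnessLib

/-!
# The tilted martingale identities (line `boundary-area-law`, RS5b′/T2, Π): the product cell

Line `boundary-area-law` of the crux `SubseqIdentification` (stmt-CriticalPhenomena-0783), restriction
reshape (lead c4, r-c4-5), stub `stub_tiltedProductMartingale` (Π) = half of step (T2) of the tilted
[LSW] Theorem 6.5 (G. F. Lawler, O. Schramm, W. Werner, *Conformal restriction: the chordal case*,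
J. Amer. Math. Soc. **16** (2003), §5 (5.1)–(5.3) and Prop. 5.3): for `0 < κ ≤ 8/3`, `α = (6−κ)/(2κ)`,
`λ = (8−3κ)(6−κ)/(2κ)`, a nonempty `*`-hull `A` and levels `n ≤ k`, the product `Mⁿ · Lᵏ` of the
localised image driving function `Mⁿ = imgMartK κ hA hne n` (`W̃ = h_t(W_t)` stopped at
`imgLocTimeK n`) with the localised compensated restriction martingale `Lᵏ = locMartK κ α λ hA hne k`
(`Ỹ = h_t′(W_t)^α e^{−λ∫m}` stopped at `locTimeK k ≥ imgLocTimeK n`) is a martingale: in print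
`d(W̃Ỹ) = W̃ dỸ + Ỹ dW̃ + d⟨W̃, Ỹ⟩ = (mart) + Ỹ h″(W) (κ/2 − 3 + κα) dt` and `κα = 3 − κ/2`.

First of three files (CELL SCHEME, no stochastic calculus): the pathwise cell. Over a cell `[u, u + h]`,
for `S ∈ 𝓕_s`, `s ≤ u`:

  `𝟙_S (M_{u+h} L_{u+h} − M_u L_u) = 𝟙_S M_u (L_{u+h} − L_u) + g · (ΔW̃ · Ŷ′) + b`

(`indicator_prod_sub_eq`), with the `𝓕_u`-measurable weight `g = 𝟙_S 𝟙{u < imgLocTimeK n} e^{−λ Iᵏ_u} ∈ [0, 1]`,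
`ΔW̃ = imageDrvFnK κ A (u+h) ∘ β − imageDrvFnK κ A u ∘ β`, `Ŷ′ = D_{u+h}^α e^{−λ ∫ᵤ^{u+h} m}` and the defect
`b = 𝟙_S 𝟙{u < imgLocTimeK n} ((M_{u+h} − M_u) L_{u+h} − e^{−λ Iᵏ_u} ΔW̃ Ŷ′)`, which vanishes unless the
localising time `imgLocTimeK n` falls in `(u, u + h)` or the driver oscillates much over the cell
(`abs_prodDefect_le`, the three-indicator form of `SLEImageLocalMartingale.abs_imgDefect_le`; the extra
factors `L_{u+h}, e^{−λI} Ŷ′ ∈ [0, 1]` only help). The first ("past") term has integral EXACTLY zero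
(`integral_prodPast_mul_sub_eq_zero`: `𝟙_S Mⁿ_u` is bounded `𝓕_u`-measurable and `Lᵏ` is a martingale);
the coefficient `κ/2 − 3 + κα` of the frozen first moment of the interior term vanishes
(`prod_coeff_eq_zero`). The interior estimate, the cell bound and the summation are the sequels
`…TiltedProductEstimate`, `…TiltedProductMartingale`.

References: [LSW] §5 (5.1)–(5.3), Prop. 5.3. No named fact is used.
-/

noncomputable section

open MeasureTheory Filter Topology Set Metric Function
open scoped NNReal ENNReal
open Literature.Probability.RandomPlanarGeometry
open Literature.Probability.Process (preWienerMeasure runSup runSup_nonneg integrable_runSup)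

namespace Summit.CriticalPhenomena.SAWScalingLimit.Theorems.SubseqIdentification.BoundaryAreaLaw

open Loewner PathOps

/-! ### The vanishing coefficient and two pathwise identities -/

section Pathwise

variable {κ : ℝ≥0} {α lam : ℝ} {A : Set ℂ} {hA : IsStarHull A} {hne : A.Nonempty} {n k : ℕ}

/-- **The cancellation `κα + κ/2 − 3 = 0`** for `α = (6 − κ)/(2κ)`, `κ > 0` (the drift of `Ỹ dW̃` against the
covariation `d⟨W̃, Ỹ⟩`). [cite: LawlerSchrammWerner2003Restriction, §5 (5.1)–(5.3) and Prop. 5.3] -/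
theorem prod_coeff_eq_zero (hκ0 : 0 < κ) (hαdef : α = (6 - κ) / (2 * κ)) : (κ : ℝ) / 2 - 3 + κ * α = 0 := by
  have hκ' : (κ : ℝ) ≠ 0 := by have : (0 : ℝ) < κ := (by exact_mod_cast hκ0); exact this.ne'
  rw [hαdef]
  field_simp
  ring

/-- **Interior cells of `Lᵏ`**: for `u + h ≤ Tₖ` (`Tₖ > 0`),
`Lᵏ_{u+h} = e^{−λ Iᵏ_u} · D_{u+h}^α e^{−λ ∫ᵤ^{u+h} m}` along the Brownian path. [folklore] -/
theorem prod_locMartK_eq_of_le {u h : ℝ≥0} {ω : ℝ≥0 → ℝ}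
    (hle : ((u + h : ℝ≥0) : WithTop ℝ≥0) ≤ locTimeK κ hA hne k ω) (hT0 : (0 : WithTop ℝ≥0) < locTimeK κ hA hne k ω) :
    locMartK κ α lam hA hne k (u + h) ω =
      Real.exp (-(lam * IpnK κ hA hne k u ω)) *
        (DFnK κ A (u + h) (brownianCPath ω) ^ α * Real.exp (-(lam * JFnK κ A u h (brownianCPath ω)))) := by
  -- adapted from SLERestrictionLocalMartingaleKappa.lean (`abs_setIntegral_cell_leK`, interior case)
  rw [locMartK, stoppedProcess, min_eq_left hle, Literature.Probability.Process.untopA_coe, YtilK]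
  obtain ⟨halive, -, hDeq, -, -⟩ := controlled_of_le_locTimeK hle hT0
  rw [hDeq, (DFnK_eq (κ := κ) (A := A) (u + h) (brownianCPath ω)).1 halive, IpnK_add_eq_JFnK hle, mul_add, neg_add,
    Real.exp_add]
  ring

/-- **Interior cells of `Mⁿ`**: for `u + h ≤ imgLocTimeK n` (`> 0`), `Mⁿ_{u+h} − Mⁿ_u = ΔW̃` along the path.
[folklore] -/
theorem prod_imgMartK_sub_eq_of_le {u h : ℝ≥0} {ω : ℝ≥0 → ℝ}
    (hle : ((u + h : ℝ≥0) : WithTop ℝ≥0) ≤ imgLocTimeK κ hA hne n ω) (h0 : (0 : WithTop ℝ≥0) < imgLocTimeK κ hA hne n ω) :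
    imgMartK κ hA hne n (u + h) ω - imgMartK κ hA hne n u ω =
      imageDrvFnK κ A (u + h) (brownianCPath ω) - imageDrvFnK κ A u (brownianCPath ω) := by
  have hu : (u : WithTop ℝ≥0) ≤ imgLocTimeK κ hA hne n ω := le_trans (by exact_mod_cast le_self_add) hle
  rw [imgMartK_eq_of_le hle, imgMartK_eq_of_le hu, (imgDrvP_eq_of_le hle h0).2.1, (imgDrvP_eq_of_le hu h0).2.1]
  ring

/-- **The product cell decomposition** (pathwise identity): with `g₀ = 𝟙_S 𝟙{u < imgLocTimeK n}`,
`C_u = e^{−λ Iᵏ_u}`, `ΔW̃ = imageDrvFnK_{u+h} − imageDrvFnK_u`, `Ŷ′ = D_{u+h}^α e^{−λ ∫ᵤ^{u+h} m}`: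
`𝟙_S (M_{u+h} L_{u+h} − M_u L_u) = 𝟙_S M_u (L_{u+h} − L_u) + g₀ C_u (ΔW̃ Ŷ′) + g₀ ((M_{u+h} − M_u) L_{u+h} − C_u ΔW̃ Ŷ′)`
(after `imgLocTimeK n` the process `Mⁿ` is frozen). [folklore] -/
theorem indicator_prod_sub_eq (S : Set (ℝ≥0 → ℝ)) (u h : ℝ≥0) (ω : ℝ≥0 → ℝ) :
    S.indicator (fun ω ↦ imgMartK κ hA hne n (u + h) ω * locMartK κ α lam hA hne k (u + h) ω -
        imgMartK κ hA hne n u ω * locMartK κ α lam hA hne k u ω) ω =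
      S.indicator (fun _ ↦ (1 : ℝ)) ω * imgMartK κ hA hne n u ω *
          (locMartK κ α lam hA hne k (u + h) ω - locMartK κ α lam hA hne k u ω) +
        (S.indicator (fun _ ↦ (1 : ℝ)) ω * {ω | (u : WithTop ℝ≥0) < imgLocTimeK κ hA hne n ω}.indicator (fun _ ↦ (1 : ℝ)) ω *
            Real.exp (-(lam * IpnK κ hA hne k u ω))) *
          ((imageDrvFnK κ A (u + h) (brownianCPath ω) - imageDrvFnK κ A u (brownianCPath ω)) *
            (DFnK κ A (u + h) (brownianCPath ω) ^ α * Real.exp (-(lam * JFnK κ A u h (brownianCPath ω))))) +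
        (S.indicator (fun _ ↦ (1 : ℝ)) ω * {ω | (u : WithTop ℝ≥0) < imgLocTimeK κ hA hne n ω}.indicator (fun _ ↦ (1 : ℝ)) ω) *
          ((imgMartK κ hA hne n (u + h) ω - imgMartK κ hA hne n u ω) * locMartK κ α lam hA hne k (u + h) ω -
            Real.exp (-(lam * IpnK κ hA hne k u ω)) *
              ((imageDrvFnK κ A (u + h) (brownianCPath ω) - imageDrvFnK κ A u (brownianCPath ω)) *
                (DFnK κ A (u + h) (brownianCPath ω) ^ α * Real.exp (-(lam * JFnK κ A u h (brownianCPath ω)))))) := by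
  by_cases h1 : ω ∈ S
  · rw [Set.indicator_of_mem h1, Set.indicator_of_mem h1]
    by_cases h2 : (u : WithTop ℝ≥0) < imgLocTimeK κ hA hne n ω
    · rw [Set.indicator_of_mem (show ω ∈ {ω | (u : WithTop ℝ≥0) < imgLocTimeK κ hA hne n ω} from h2)]; ring
    · rw [Set.indicator_of_notMem (show ω ∉ {ω | (u : WithTop ℝ≥0) < imgLocTimeK κ hA hne n ω} from h2)]
      obtain ⟨T₀, hT₀⟩ := WithTop.ne_top_iff_exists.1 (imgLocTimeK_ne_top (κ := κ) (hA := hA) (hne := hne) n ω)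
      have hTu : T₀ ≤ u := by
        have := not_lt.1 h2; rw [← hT₀] at this; exact_mod_cast this
      rw [imgMartK_eq_of_ge hT₀.symm (hTu.trans le_self_add), imgMartK_eq_of_ge hT₀.symm hTu]; ring
  · rw [Set.indicator_of_notMem h1, Set.indicator_of_notMem h1]; ring

/-- **The defect of the product cell, pointwise.** On `{u < imgLocTimeK n}` (`n ≤ k`), with `A ⊆ B̄(0, R)`,
`u ≤ t₁`, `h ≤ 1`, a threshold `κ₀ > 0` with `stepSize κ₀ h ≤ cₙ(cₙ/16)/1000`, `Bad = {κ₀/σ ≤ osc_h(incr_u β)}`,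
`E = {u < imgLocTimeK n < u + h}`:
`|(M_{u+h} − M_u) L_{u+h} − C_u ΔW̃ Ŷ′| ≤ 𝟙_E (100h/(cₙ/16) + 8κ₀) + (2N₀ + Q) 𝟙_Bad + 3482√κ 𝟙_Bad runSup (u+h)`
(`N₀` the bound of `Mⁿ`, `Q = 15080√(t₁+1) + 1160R`): interior cells have no defect
(`prod_locMartK_eq_of_le`, `prod_imgMartK_sub_eq_of_le`, `imgLocTimeK n ≤ locTimeK n ≤ locTimeK k`); on a
boundary cell with small oscillation both `M_{u+h} − M_u` and `ΔW̃` are `O(h/ρ₀ + κ₀)`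
(`abs_imgMartK_sub_sub_le`, `abs_imageDriver_sub_le_of_lt_imgLocTimeK`) and `L, C_u Ŷ′ ∈ [0, 1]`.
[cite: LawlerSchrammWerner2003Restriction, §5 (5.1)–(5.3) and Prop. 5.3] -/
theorem abs_prodDefect_le (hκ : κ ≤ 8 / 3) (hα : 0 < α) (hlam : 0 ≤ lam) (hnk : n ≤ k) {R : ℝ} (hR0 : 0 < R)
    (hAR : A ⊆ closedBall (0 : ℂ) R) {u h t₁ : ℝ≥0} (hut : u ≤ t₁) (hh0 : 0 < h) (hh1 : (h : ℝ) ≤ 1) {κ₀ : ℝ}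
    (hκ₀ : 0 < κ₀) (hh2 : stepSize κ₀ h ≤ locLevel n * (locLevel n / 16) / 1000) {ω : ℝ≥0 → ℝ}
    (hu : (u : WithTop ℝ≥0) < imgLocTimeK κ hA hne n ω) :
    |(imgMartK κ hA hne n (u + h) ω - imgMartK κ hA hne n u ω) * locMartK κ α lam hA hne k (u + h) ω -
        Real.exp (-(lam * IpnK κ hA hne k u ω)) *
          ((imageDrvFnK κ A (u + h) (brownianCPath ω) - imageDrvFnK κ A u (brownianCPath ω)) *
            (DFnK κ A (u + h) (brownianCPath ω) ^ α * Real.exp (-(lam * JFnK κ A u h (brownianCPath ω)))))| ≤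
      {ω | (u : WithTop ℝ≥0) < imgLocTimeK κ hA hne n ω ∧ imgLocTimeK κ hA hne n ω < ((u + h : ℝ≥0) : WithTop ℝ≥0)}.indicator
          (fun _ ↦ 100 * (h : ℝ) / (locLevel n / 16) + 8 * κ₀) ω +
        (2 * (((n : ℝ) + 1) + 1160 * (3 * ((n : ℝ) + 1) + 13 * Real.sqrt ((n : ℝ) + 1) + R)) +
            (15080 * Real.sqrt ((t₁ : ℝ) + 1) + 1160 * R)) *
          {ω | κ₀ / stepSigma ≤ oscFn h (incr u (brownianCPath ω))}.indicator (fun _ ↦ (1 : ℝ)) ω +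
        3482 * Real.sqrt κ * ({ω | κ₀ / stepSigma ≤ oscFn h (incr u (brownianCPath ω))}.indicator (fun _ ↦ (1 : ℝ)) ω *
          runSup (u + h) ω) := by
  -- adapted from SLEImageLocalMartingale.lean (`abs_imgDefect_le`)
  have hc0 := (locLevel_pos_le n).1
  have hσ := stepSigma_pos
  have h0 : (0 : WithTop ℝ≥0) < imgLocTimeK κ hA hne n ω := lt_of_le_of_lt bot_le hu
  have hτT : imgLocTimeK κ hA hne n ω ≤ locTimeK κ hA hne k ω :=
    (imgLocTimeK_le_locTimeK n ω).trans (monotone_locTimeK ω hnk)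
  have hT0 : (0 : WithTop ℝ≥0) < locTimeK κ hA hne k ω := h0.trans_le hτT
  have hX0 : 0 ≤ runSup (u + h) ω := runSup_nonneg _ ω
  have hD0 : 0 ≤ 100 * (h : ℝ) / (locLevel n / 16) + 8 * κ₀ := by positivity
  have hE0 : 0 ≤ {ω | (u : WithTop ℝ≥0) < imgLocTimeK κ hA hne n ω ∧ imgLocTimeK κ hA hne n ω < ((u + h : ℝ≥0) : WithTop ℝ≥0)}.indicator
      (fun _ ↦ 100 * (h : ℝ) / (locLevel n / 16) + 8 * κ₀) ω := Set.indicator_nonneg (fun _ _ ↦ hD0) ω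
  have hN₀0 : 0 ≤ ((n : ℝ) + 1) + 1160 * (3 * ((n : ℝ) + 1) + 13 * Real.sqrt ((n : ℝ) + 1) + R) := by positivity
  have hQ0 : 0 ≤ 15080 * Real.sqrt ((t₁ : ℝ) + 1) + 1160 * R := by positivity
  -- the four factors
  set ΔM : ℝ := imgMartK κ hA hne n (u + h) ω - imgMartK κ hA hne n u ω with hΔM
  set L : ℝ := locMartK κ α lam hA hne k (u + h) ω with hL
  set Cu : ℝ := Real.exp (-(lam * IpnK κ hA hne k u ω)) with hCu
  set ΔΦ : ℝ := imageDrvFnK κ A (u + h) (brownianCPath ω) - imageDrvFnK κ A u (brownianCPath ω) with hΔΦ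
  set Yh : ℝ := DFnK κ A (u + h) (brownianCPath ω) ^ α * Real.exp (-(lam * JFnK κ A u h (brownianCPath ω))) with hYh
  have hL01 : 0 ≤ L ∧ L ≤ 1 := locMartK_mem_Icc (κ := κ) (hA := hA) (hne := hne) (n := k) hα hlam (u + h) ω
  have hCu01 : 0 ≤ Cu ∧ Cu ≤ 1 :=
    ⟨(Real.exp_pos _).le, by rw [hCu, Real.exp_le_one_iff, neg_nonpos]; exact mul_nonneg hlam (IpnK_nonneg k u ω)⟩
  have hYh01 : 0 ≤ Yh ∧ Yh ≤ 1 := by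
    obtain ⟨-, -, e0, e1⟩ := DFnK_eq (κ := κ) (A := A) (u + h) (brownianCPath ω)
    have c1 : Real.exp (-(lam * JFnK κ A u h (brownianCPath ω))) ≤ 1 := by
      rw [Real.exp_le_one_iff, neg_nonpos]; exact mul_nonneg hlam (JFnK_nonneg hA u h _)
    exact ⟨mul_nonneg (Real.rpow_nonneg e0 _) (Real.exp_pos _).le,
      mul_le_one₀ (Real.rpow_le_one e0 e1 hα.le) (Real.exp_pos _).le c1⟩
  have hCY01 : 0 ≤ Cu * Yh ∧ Cu * Yh ≤ 1 := ⟨mul_nonneg hCu01.1 hYh01.1, mul_le_one₀ hCu01.2 hYh01.1 hYh01.2⟩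
  -- the crude bound `|ΔM L − Cu ΔΦ Yh| ≤ |ΔM| + |ΔΦ|`
  have hcrude : |ΔM * L - Cu * (ΔΦ * Yh)| ≤ |ΔM| + |ΔΦ| := by
    have e1 : |ΔM * L| ≤ |ΔM| := by
      rw [abs_mul, abs_of_nonneg hL01.1]; exact mul_le_of_le_one_right (abs_nonneg _) hL01.2
    have e2 : |Cu * (ΔΦ * Yh)| ≤ |ΔΦ| := by
      rw [show Cu * (ΔΦ * Yh) = ΔΦ * (Cu * Yh) by ring, abs_mul, abs_of_nonneg hCY01.1]
      exact mul_le_of_le_one_right (abs_nonneg _) hCY01.2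
    calc _ ≤ |ΔM * L| + |Cu * (ΔΦ * Yh)| := abs_sub _ _
      _ ≤ _ := add_le_add e1 e2
  by_cases hbad : ω ∈ {ω | κ₀ / stepSigma ≤ oscFn h (incr u (brownianCPath ω))}
  · -- large oscillation: the crude bound and the envelopes
    rw [Set.indicator_of_mem hbad, mul_one, one_mul]
    have e1 : |ΔM| ≤ 2 * (((n : ℝ) + 1) + 1160 * (3 * ((n : ℝ) + 1) + 13 * Real.sqrt ((n : ℝ) + 1) + R)) := by
      calc _ ≤ |imgMartK κ hA hne n (u + h) ω| + |imgMartK κ hA hne n u ω| := abs_sub _ _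
        _ ≤ _ := by have := abs_imgMartK_le (κ := κ) (hA := hA) (hne := hne) (n := n) hR0 hAR (u + h) ω
                    have := abs_imgMartK_le (κ := κ) (hA := hA) (hne := hne) (n := n) hR0 hAR u ω; linarith
    have e2 : |ΔΦ| ≤ 3482 * Real.sqrt κ * runSup (u + h) ω + (15080 * Real.sqrt ((t₁ : ℝ) + 1) + 1160 * R) := by
      have := abs_imageDrvFnK_brownianCPath_sub_leK (κ := κ) hA hR0 hAR u h ω
      have hsq : Real.sqrt ((u + h : ℝ≥0) : ℝ) ≤ Real.sqrt ((t₁ : ℝ) + 1) :=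
        Real.sqrt_le_sqrt (by push_cast; exact add_le_add (by exact_mod_cast hut) hh1)
      linarith [mul_le_mul_of_nonneg_left hsq (by norm_num : (0 : ℝ) ≤ 15080)]
    linarith [hcrude, e1, e2, hE0]
  · -- small oscillation
    rw [Set.indicator_of_notMem hbad, mul_zero, zero_mul, mul_zero, add_zero, add_zero]
    have hosc : oscFn h (incr u (brownianCPath ω)) < κ₀ / stepSigma := not_le.1 hbad
    have hS' : ∀ r : ℝ≥0, r ≤ h → |drvK κ (brownianCPath ω) (u + r) - drvK κ (brownianCPath ω) u| ≤ κ₀ := fun r hr ↦ by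
      -- adapted from SLERestrictionLocalMartingaleKappa.lean
      have h1 := abs_incr_le_oscFn hr u (brownianCPath ω)
      have : drvK κ (brownianCPath ω) (u + r) - drvK κ (brownianCPath ω) u =
          Real.sqrt κ * ((brownianCPath ω) (u + r) - (brownianCPath ω) u) := by simp only [drvK]; ring
      rw [this, abs_mul, abs_of_nonneg (Real.sqrt_nonneg _)]
      have hle1 := (lt_div_iff₀' hσ).1 (lt_of_le_of_lt h1 hosc) |>.le
      calc Real.sqrt κ * |(brownianCPath ω) (u + r) - (brownianCPath ω) u|
          ≤ stepSigma * |(brownianCPath ω) (u + r) - (brownianCPath ω) u| :=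
            mul_le_mul_of_nonneg_right (sqrt_le_stepSigma hκ) (abs_nonneg _)
        _ ≤ κ₀ := hle1
    rcases le_or_gt (((u + h : ℝ≥0) : WithTop ℝ≥0)) (imgLocTimeK κ hA hne n ω) with hle | hlt
    · -- interior cell: no defect
      have hM : ΔM = ΔΦ := prod_imgMartK_sub_eq_of_le hle h0
      have hLe : L = Cu * Yh := prod_locMartK_eq_of_le (hle.trans hτT) hT0
      rw [hM, hLe, show ΔΦ * (Cu * Yh) - Cu * (ΔΦ * Yh) = 0 by ring, abs_zero]
      exact hE0
    · -- boundary cell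
      rw [Set.indicator_of_mem (show ω ∈ {ω | (u : WithTop ℝ≥0) < imgLocTimeK κ hA hne n ω ∧
        imgLocTimeK κ hA hne n ω < ((u + h : ℝ≥0) : WithTop ℝ≥0)} from ⟨hu, hlt⟩)]
      obtain ⟨-, hbd⟩ := abs_imgMartK_sub_sub_le (κ := κ) hu hh0 hS' hh2
      obtain ⟨haliveh, e2⟩ := abs_imageDriver_sub_le_of_lt_imgLocTimeK (κ := κ) hu hS' hh2 hh0 le_rfl
      have halive_u := (imgDrvP_eq_of_le hu.le h0).1
      have hΦ : ΔΦ = imageDriver (drvK κ (brownianCPath ω)) A (u + h) - imageDriver (drvK κ (brownianCPath ω)) A u := by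
        rw [hΔΦ, imageDrvFnK_of_alive haliveh, imageDrvFnK_of_alive halive_u, imageDriver, imageDriver]; ring
      have e2' : |ΔΦ| ≤ 25 * h / (locLevel n / 16) + 2 * κ₀ := by rw [hΦ]; exact e2
      have htri : |ΔM| ≤ |ΔM - ΔΦ| + |ΔΦ| := by
        have := abs_add_le (ΔM - ΔΦ) ΔΦ; rwa [sub_add_cancel] at this
      have hbd' : |ΔM - ΔΦ| ≤ 50 * h / (locLevel n / 16) + 4 * κ₀ := hbd
      have hring : (50 * (h : ℝ) / (locLevel n / 16) + 4 * κ₀) + (25 * h / (locLevel n / 16) + 2 * κ₀) +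
          (25 * h / (locLevel n / 16) + 2 * κ₀) = 100 * (h : ℝ) / (locLevel n / 16) + 8 * κ₀ := by ring
      linarith [hcrude]

end Pathwise

/-! ### The past term has integral exactly zero -/

section Past

variable {κ : ℝ≥0} {α lam : ℝ} {A : Set ℂ} {hA : IsStarHull A} {hne : A.Nonempty} {n k : ℕ}

/-- **The past term integrates to zero**: for `s ≤ u`, `S ∈ 𝓕_s`,
`∫ 𝟙_S M_u (L_{u+h} − L_u) = 0`, because `𝟙_S Mⁿ_u` is bounded and `𝓕_u`-measurable and `Lᵏ` is a
martingale (`martingale_locMartK`): `E[F L_{u+h}] = E[F · E[L_{u+h} | 𝓕_u]] = E[F L_u]`.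
[cite: LawlerSchrammWerner2003Restriction, Prop. 5.3] -/
theorem integral_prodPast_mul_sub_eq_zero (hκ0 : 0 < κ) (hκ : κ ≤ 8 / 3) (hαdef : α = (6 - κ) / (2 * κ))
    (hlamdef : lam = (8 - 3 * κ) * (6 - κ) / (2 * κ)) {s u h : ℝ≥0} (hsu : s ≤ u) {S : Set (ℝ≥0 → ℝ)}
    (hS : MeasurableSet[brownianFiltration s] S) :
    ∫ ω, S.indicator (fun _ ↦ (1 : ℝ)) ω * imgMartK κ hA hne n u ω *
        (locMartK κ α lam hA hne k (u + h) ω - locMartK κ α lam hA hne k u ω) ∂preWienerMeasure = 0 := by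
  haveI := isProbabilityMeasure_preWienerMeasure'
  obtain ⟨hαpos, hlam0⟩ := exponents_pos hκ hαdef hlamdef hκ0
  have hmart : Martingale (locMartK κ α lam hA hne k) brownianFiltration preWienerMeasure :=
    martingale_locMartK hκ0 hκ hαdef hlamdef
  set F : (ℝ≥0 → ℝ) → ℝ := fun ω ↦ S.indicator (fun _ ↦ (1 : ℝ)) ω * imgMartK κ hA hne n u ω with hF
  have hFm : StronglyMeasurable[brownianFiltration u] F :=
    (stronglyMeasurable_const.indicator (brownianFiltration.mono hsu _ hS)).mul ((stronglyAdapted_imgMartK n) u)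
  obtain ⟨N, hN0, hN⟩ := exists_forall_abs_imgMartK_le (κ := κ) hA hne n
  have hFb : ∀ᵐ ω ∂preWienerMeasure, ‖F ω‖ ≤ N := Eventually.of_forall fun ω ↦ by
    rw [Real.norm_eq_abs, hF]; simp only
    rw [abs_mul]
    by_cases hω : ω ∈ S
    · rw [Set.indicator_of_mem hω, abs_one, one_mul]; exact hN u ω
    · rw [Set.indicator_of_notMem hω, abs_zero, zero_mul]; exact hN0
  have hFm' : AEStronglyMeasurable F preWienerMeasure := (hFm.mono (brownianFiltration.le u)).aestronglyMeasurable
  have iL : ∀ t, Integrable (locMartK κ α lam hA hne k t) preWienerMeasure := fun t ↦ integrable_locMartK hαpos hlam0 t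
  have iFL : ∀ t, Integrable (F * locMartK κ α lam hA hne k t) preWienerMeasure := fun t ↦
    (iL t).bdd_mul hFm' hFb
  have hm : brownianFiltration u ≤ (inferInstance : MeasurableSpace (ℝ≥0 → ℝ)) := brownianFiltration.le u
  haveI : IsFiniteMeasure (preWienerMeasure.trim hm) := isFiniteMeasure_trim hm
  -- `E[F L_{u+h}] = E[F L_u]`
  have key : ∫ ω, (F * locMartK κ α lam hA hne k (u + h)) ω ∂preWienerMeasure =
      ∫ ω, (F * locMartK κ α lam hA hne k u) ω ∂preWienerMeasure := by
    rw [← integral_condExp hm (f := F * locMartK κ α lam hA hne k (u + h))]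
    refine integral_congr_ae ((condExp_mul_of_stronglyMeasurable_left hFm (iFL (u + h)) (iL (u + h))).trans ?_)
    filter_upwards [hmart.condExp_ae_eq (i := u) (j := u + h) le_self_add] with ω hω
    simp only [Pi.mul_apply]
    rw [hω]
  have e : (fun ω ↦ S.indicator (fun _ ↦ (1 : ℝ)) ω * imgMartK κ hA hne n u ω *
      (locMartK κ α lam hA hne k (u + h) ω - locMartK κ α lam hA hne k u ω)) =
      fun ω ↦ (F * locMartK κ α lam hA hne k (u + h)) ω - (F * locMartK κ α lam hA hne k u) ω := by
    funext ω; simp only [Pi.mul_apply, hF]; ring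
  rw [e, integral_sub (iFL _) (iFL _), key, sub_self]

end Past

section Registered

/-- **Registered form** (explicit binders) of `prod_coeff_eq_zero`: `κ/2 − 3 + κα = 0` for `α = (6 − κ)/(2κ)`.
[cite: LawlerSchrammWerner2003Restriction, §5 (5.1)–(5.3) and Prop. 5.3] -/
theorem prod_coeff_eq_zero_registered :
    ∀ (κ : ℝ≥0) (α : ℝ), 0 < κ → α = (6 - κ) / (2 * κ) → (κ : ℝ) / 2 - 3 + κ * α = 0 :=
  fun _ _ hκ0 hαdef ↦ prod_coeff_eq_zero hκ0 hαdef

end Registered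

end Summit.CriticalPhenomena.SAWScalingLimit.Theorems.SubseqIdentification.BoundaryAreaLaw

end
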